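import Literature.AlgebraicGeometry.Limits.GenericFibreSpread
import Literature.RingTheory.Flat.GenericFreeness
import Mathlib.RingTheory.Nilpotent.Lemmas
import Mathlib.RingTheory.Ideal.Maximal
import Mathlib.RingTheory.Localization.BaseChange
import Mathlib.RingTheory.Localization.Away.Basic
import Mathlib.RingTheory.Localization.Away.AdjoinRoot
import Mathlib.RingTheory.Localization.Ideal
import Mathlib.RingTheory.Nilpotent.Basic
import Mathlib.RingTheory.FinitePresentation
import Mathlib.RingTheory.TensorProduct.Basic
import Mathlib.RingTheory.TensorProduct.Quotient
import Mathlib.RingTheory.TensorProduct.MvPolynomial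
import Mathlib.RingTheory.Polynomial.Quotient
import Mathlib.RingTheory.Flat.Localization
import Mathlib.Algebra.Module.Projective
import Mathlib.Algebra.Exact.Basic
import Mathlib.LinearAlgebra.TensorProduct.RightExactness
import Mathlib.AlgebraicGeometry.Pullbacks
import HarnessLib

/-!
# Spreading out from the generic point: a non-integral generic fibre has non-integral neighbours

Topic: `Literature/AlgebraicGeometry/Limits` (EGA IV₃ §§8–9, 12, "spreading out"; continues
`GenericFibreSpread.lean`). For a family of affine schemes of finite type over a Noetherian
integral base `Spec B` with fraction field `K` — an algebra `R` of finite type over `B`, with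
generic fibre ring `K ⊗_B R` and fibre rings `k ⊗_B R` at the field-valued points `B → k` — we
PROVE:

  **if the generic fibre `K ⊗_B R` is not an integral domain, then there is `b ≠ 0` in `B` such
  that no fibre `k ⊗_B R` at a field-valued point of `D(b)` is an integral domain**
  (`exists_forall_not_isDomain_tensor`), and the same for the zero schemes `V(J) ⊆ 𝔸ⁿ` of an
  ideal `J ⊆ B[x₁, …, xₙ]` and their fibres `k[x]/(J·k[x])`
  (`exists_forall_not_isDomain_mvPolynomial`, via `tensorQuotientMvPolynomialEquiv :
  k ⊗_B (B[x]/J) ≃ₐ[k] k[x]/(J·k[x])`).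

This is the "Case B" input of the spreading-out step `SpreadsShapedFromGenericPoint` of
`Literature/AlgebraicGeometry/Resolution/CanonicalResolutionSpread.lean` (there the shape clause
of a resolution is conditional on the INTEGRALITY of the fibre `V(S_k)`; when the generic zero
scheme is not integral, no nearby fibre is, and the clause is vacuous).

Proof. Write every element of `K ⊗_B R` as a unit multiple of some `1 ⊗ r`
(`exists_mul_eq_one_tmul`; `K ⊗_B R` is the localisation of `R` at `B ∖ 0`, Mathlib
`IsLocalization.tensorProduct_isLocalizedModule`), and note `1 ⊗ r = 0 ↔ b·r = 0` for some
`b ≠ 0` (`one_tmul_eq_zero_iff`), a relation which persists in every fibre over `D(b)`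
(`one_tmul_eq_zero_of_smul_eq_zero`). Three cases:
* `K ⊗_B R = 0`: then `b · 1_R = 0`, `b ≠ 0`, and all fibres over `D(b)` vanish.
* zero-divisors `(1 ⊗ r)(1 ⊗ s) = 0` with `1 ⊗ r`, `1 ⊗ s` NOT nilpotent: non-nilpotency spreads
  (`exists_forall_not_isNilpotent_one_tmul`): a prime of `R` over `(0)` avoiding `r` is a point of
  the generic fibre of `Spec R[1/r] → Spec B`, so by CHEVALLEY (`exists_basicOpen_subset_range`,
  `GenericFibreSpread.lean`) all fibres of `Spec R[1/r]` over some `D(b)` are non-empty, i.e.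
  `k ⊗_B R[1/r] ≠ 0`, where `1 ⊗ r` becomes a unit — so `1 ⊗ r` is not nilpotent in `k ⊗_B R`.
* a non-zero NILPOTENT `1 ⊗ r` (non-reduced generic fibre): non-vanishing spreads
  (`exists_forall_one_tmul_ne_zero`) — this needs flatness: by GENERIC FREENESS (the tree's named
  fact `GortzWedhorn2020_10_83`, Görtz–Wedhorn I Thm. 10.83, applied to the `R`-module `R/(r)`)
  the sequence `0 → R/Ann(r) —·r→ R → R/(r) → 0` splits over `B[1/b₁]`, so
  `k ⊗ R/Ann(r) → k ⊗ R` stays injective over `D(b₁)` (`lTensor_injective_of_free_localizedModule`),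
  and `k ⊗_B R/Ann(r) ≠ 0` over some `D(b₂)` by Chevalley again (`exists_forall_nontrivial_tensor`,
  using a prime of `R/Ann(r)` over `(0)`, which exists because `Ann(r)` misses `B ∖ 0`).

## Main statements (all PROVED; the generic freeness fact enters as a hypothesis `hGF`)

* `exists_mul_eq_one_tmul`, `one_tmul_eq_zero_iff`, `one_tmul_eq_zero_of_smul_eq_zero`;
* `locallyOfFinitePresentation_specMap_algebraMap`, `nontrivial_of_nonempty_spec`,
  `exists_forall_nontrivial_tensor`, `exists_forall_not_isNilpotent_one_tmul`;
* `lTensor_injective_of_free_localizedModule`, `exists_forall_one_tmul_ne_zero`;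
* `isUnit_algebraMap_tmul_one`, `exists_prime_notMem_of_not_isNilpotent`,
  **`exists_forall_not_isDomain_tensor`**;
* `map_includeRight_map_algebraTensorAlgEquiv`, `tensorQuotientMvPolynomialEquiv` (DEFINITION,
  the fibre rings of `V(J) → Spec B`), **`exists_forall_not_isDomain_mvPolynomial`**.

## References

* A. Grothendieck, J. Dieudonné, EGA IV₂ (1965) 6.9.1–6.9.2 (generic flatness/freeness), IV₃
  (1966) 9.7.7, 12.1.1 (constructibility of properties of fibres).
* U. Görtz, T. Wedhorn, *Algebraic Geometry I: Schemes*, 2nd ed. (2020), Thm. 10.83 (generic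
  freeness), Thm. 10.84/Cor. 10.85 (generic flatness) — through
  `Literature/RingTheory/Flat/GenericFreeness.lean`. [GortzWedhorn2020]
* The Stacks Project, Tags 054K (Chevalley), 051R (generic freeness).
-/

noncomputable section

universe u

open CategoryTheory CategoryTheory.Limits AlgebraicGeometry TopologicalSpace Topology
  PrimeSpectrum TensorProduct

namespace Literature.AlgebraicGeometry.Limits

section Generic

variable {B : Type u} [CommRing B] [IsDomain B] (K : Type u) [Field K] [Algebra B K]
  [IsFractionRing B K] {R : Type u} [CommRing R] [Algebra B R]

/-- **Clearing denominators in the generic fibre**: every element of `K ⊗_B R` is a unit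
multiple of an element of `R`: `(b ⊗ 1) · x = 1 ⊗ r` for some `b ≠ 0` (`K ⊗_B R` is the
localisation of `R` at the non-zero elements of `B`). [folklore] -/
theorem exists_mul_eq_one_tmul (x : K ⊗[B] R) :
    ∃ b : B, b ≠ 0 ∧ ∃ r : R, algebraMap B K b ⊗ₜ[B] (1 : R) * x = 1 ⊗ₜ[B] r := by
  obtain ⟨⟨r, s⟩, h⟩ := IsLocalizedModule.surj (nonZeroDivisors B) (TensorProduct.mk B K R 1) x
  refine ⟨s, nonZeroDivisors.ne_zero s.2, r, ?_⟩
  have h' : (s : B) • x = (1 : K) ⊗ₜ[B] r := by simpa [Submonoid.smul_def] using h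
  rw [← h', Algebra.smul_def, Algebra.TensorProduct.algebraMap_apply]

/-- **The kernel of `R → K ⊗_B R`**: `1 ⊗ r = 0` iff `b · r = 0` for some `b ≠ 0`. [folklore] -/
theorem one_tmul_eq_zero_iff (r : R) :
    (1 : K) ⊗ₜ[B] r = 0 ↔ ∃ b : B, b ≠ 0 ∧ b • r = 0 := by
  have h := IsLocalizedModule.eq_zero_iff (nonZeroDivisors B) (TensorProduct.mk B K R 1) (m := r)
  simp only [TensorProduct.mk_apply] at h
  rw [h]
  constructor
  · rintro ⟨s, hs⟩
    exact ⟨s, nonZeroDivisors.ne_zero s.2, hs⟩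
  · rintro ⟨b, hb, hbr⟩
    exact ⟨⟨b, mem_nonZeroDivisors_of_ne_zero hb⟩, hbr⟩

omit [IsDomain B] [IsFractionRing B K] in
/-- In a fibre `k ⊗_B R` over a `B`-algebra `k` in which `b` is invertible, `b · r = 0` forces
`1 ⊗ r = 0`. [folklore] -/
theorem one_tmul_eq_zero_of_smul_eq_zero {k : Type u} [CommRing k] [Algebra B k] {b : B}
    (hb : IsUnit (algebraMap B k b)) {r : R} (hbr : b • r = 0) : (1 : k) ⊗ₜ[B] r = 0 := by
  have h1 : algebraMap B k b ⊗ₜ[B] r = 0 := by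
    rw [Algebra.algebraMap_eq_smul_one, TensorProduct.smul_tmul, hbr, TensorProduct.tmul_zero]
  obtain ⟨u, hu⟩ := hb
  calc (1 : k) ⊗ₜ[B] r = ((↑u⁻¹ : k) ⊗ₜ[B] (1 : R)) * ((u : k) ⊗ₜ[B] r) := by
        rw [Algebra.TensorProduct.tmul_mul_tmul, one_mul, Units.inv_mul]
    _ = 0 := by rw [hu, h1, mul_zero]

end Generic


section NonNilpotent

variable {B : Type u} [CommRing B] [IsDomain B] {R : Type u} [CommRing R] [Algebra B R]

omit [IsDomain B] in
/-- The structure morphism `Spec A → Spec B` of an algebra of finite type over a Noetherian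
ring is locally of finite presentation. [folklore] -/
theorem locallyOfFinitePresentation_specMap_algebraMap [IsNoetherianRing B] (A : Type u)
    [CommRing A] [Algebra B A] [Algebra.FiniteType B A] :
    LocallyOfFinitePresentation (Spec.map (CommRingCat.ofHom (algebraMap B A))) := by
  rw [HasRingHomProperty.Spec_iff (P := @LocallyOfFinitePresentation), CommRingCat.hom_ofHom,
    RingHom.finitePresentation_algebraMap]
  exact (Algebra.FinitePresentation.of_finiteType (R := B) (A := A)).mp inferInstance

/-- A scheme-theoretic point of `Spec A` makes `A` non-trivial. [folklore] -/
theorem nontrivial_of_nonempty_spec {A : Type u} [CommRing A]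
    (h : Nonempty ↑(Spec (CommRingCat.of A))) : Nontrivial A := by
  obtain ⟨x⟩ := h
  refine nontrivial_of_ne (0 : A) 1 fun h01 => x.2.ne_top ?_
  rw [Ideal.eq_top_iff_one, ← h01]
  exact zero_mem _

/-- **Non-nilpotency in the generic fibre spreads to the fibres over a dense open** (Chevalley
for `Spec R[1/r] → Spec B`): if some prime of `R` lying over the generic point of the Noetherian
domain `B` avoids `r`, then there is `b ≠ 0` such that `1 ⊗ r` is not nilpotent in the fibre
`k ⊗_B R` at every field-valued point `B → k` at which `b` does not vanish. [folklore] -/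
theorem exists_forall_not_isNilpotent_one_tmul [IsNoetherianRing B] [Algebra.FiniteType B R]
    (r : R) (h0 : ∃ Q : Ideal R, Q.IsPrime ∧ r ∉ Q ∧ Q.comap (algebraMap B R) = ⊥) :
    ∃ b : B, b ≠ 0 ∧ ∀ (k : Type u) [Field k] [Algebra B k], algebraMap B k b ≠ 0 →
      ¬ IsNilpotent ((1 : k) ⊗ₜ[B] r) := by
  classical
  -- the finite type `B`-algebra `R[1/r]` and `f : Spec R[1/r] → Spec B`
  haveI : Algebra.FinitePresentation R (Localization.Away r) :=
    IsLocalization.Away.finitePresentation r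
  haveI : Algebra.FiniteType B (Localization.Away r) :=
    Algebra.FiniteType.trans (S := R) inferInstance inferInstance
  haveI := locallyOfFinitePresentation_specMap_algebraMap (B := B) (Localization.Away r)
  set f := Spec.map (CommRingCat.ofHom (algebraMap B (Localization.Away r))) with hf
  -- the generic point is in the image: the prime `Q (Localization.Away r)`
  obtain ⟨Q, hQ, hrQ, hQB⟩ := h0
  have hdisj : Disjoint (Submonoid.powers r : Set R) Q := by
    refine Set.disjoint_left.mpr ?_
    rintro _ ⟨m, rfl⟩ hm
    exact hrQ (hQ.mem_of_pow_mem m hm)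
  haveI hQ' : (Q.map (algebraMap R (Localization.Away r))).IsPrime :=
    IsLocalization.isPrime_of_isPrime_disjoint (Submonoid.powers r) (Localization.Away r) Q hQ hdisj
  have hgen : (⊥ : PrimeSpectrum B) ∈ Set.range f := by
    refine ⟨⟨Q.map (algebraMap R (Localization.Away r)), hQ'⟩, PrimeSpectrum.ext ?_⟩
    change ((Q.map (algebraMap R (Localization.Away r))).comap
      (algebraMap B (Localization.Away r))) = ⊥
    rw [IsScalarTower.algebraMap_eq B R (Localization.Away r), ← Ideal.comap_comap,
      ← Ideal.under_def R,
      IsLocalization.under_map_of_isPrime_disjoint (Submonoid.powers r) (Localization.Away r) hQ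
        hdisj]
    exact hQB
  obtain ⟨b, hb, hbf⟩ := exists_basicOpen_subset_range f hgen
  refine ⟨b, hb, fun k _ _ hbk hnil => ?_⟩
  -- the fibre `(Localization.Away r) ⊗_B k` is non-empty, hence a non-trivial ring
  have hne : Nonempty ↑(pullback f (Spec.map (CommRingCat.ofHom (algebraMap B k)))) :=
    nonempty_pullback_of_subset_range f hbf (algebraMap B k) hbk
  haveI : Nontrivial ((Localization.Away r) ⊗[B] k) := by
    refine nontrivial_of_nonempty_spec ?_
    obtain ⟨z⟩ := hne
    exact ⟨(pullbackSpecIso B (Localization.Away r) k).hom z⟩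
  -- `1 ⊗ r ↦ r/1 ⊗ 1`, a unit, along `k ⊗_B R → (Localization.Away r) ⊗_B k`
  let ψ : k ⊗[B] R →ₐ[B] (Localization.Away r) ⊗[B] k :=
    (Algebra.TensorProduct.comm B k (Localization.Away r)).toAlgHom.comp
      (Algebra.TensorProduct.map (AlgHom.id B k) (IsScalarTower.toAlgHom B R (Localization.Away r)))
  have hψ : ψ ((1 : k) ⊗ₜ[B] r) = algebraMap R (Localization.Away r) r ⊗ₜ[B] (1 : k) := by
    simp [ψ]
  have hunit : IsUnit (ψ ((1 : k) ⊗ₜ[B] r)) := by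
    rw [hψ]
    exact (IsLocalization.Away.algebraMap_isUnit r).map
      (Algebra.TensorProduct.includeLeft :
        (Localization.Away r) →ₐ[B] (Localization.Away r) ⊗[B] k)
  exact (hnil.map ψ).not_isUnit hunit

end NonNilpotent

section SplitInjective

variable {B : Type u} [CommRing B]

/-- **A monomorphism with generically free cokernel stays injective in the fibres over `D(b)`**:
if `0 → M' → M → N → 0` is an exact sequence of `B`-modules and `N[1/b]` is a free
`B[1/b]`-module (as provided by generic freeness), then `k ⊗_B M' → k ⊗_B M` is injective for
every `B`-algebra `k` in which `b` is invertible (over `B[1/b]` the sequence splits, and split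
monomorphisms survive any base change). [folklore] -/
theorem lTensor_injective_of_free_localizedModule {M' M N : Type u} [AddCommGroup M']
    [Module B M'] [AddCommGroup M] [Module B M] [AddCommGroup N] [Module B N]
    {ι : M' →ₗ[B] M} {π : M →ₗ[B] N} (hι : Function.Injective ι) (hex : Function.Exact ι π)
    (hπ : Function.Surjective π) (b : B)
    (hfree : Module.Free (Localization.Away b) (LocalizedModule (Submonoid.powers b) N))
    (k : Type u) [CommRing k] [Algebra B k] (hb : IsUnit (algebraMap B k b)) :
    Function.Injective (ι.lTensor k) := by
  -- Step 1: over `L = B[1/b]` the sequence is exact and splits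
  haveI : Module.Flat B (Localization.Away b) := IsLocalization.flat _ (Submonoid.powers b)
  have hιL : Function.Injective (ι.baseChange (Localization.Away b)) := by
    rw [LinearMap.baseChange_eq_ltensor]
    exact Module.Flat.lTensor_preserves_injective_linearMap ι hι
  have hexL : Function.Exact (ι.baseChange (Localization.Away b))
      (π.baseChange (Localization.Away b)) := by
    rw [LinearMap.baseChange_eq_ltensor, LinearMap.baseChange_eq_ltensor]
    exact lTensor_exact (Localization.Away b) hex hπ
  have hπL : Function.Surjective (π.baseChange (Localization.Away b)) := by
    rw [LinearMap.baseChange_eq_ltensor]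
    exact LinearMap.lTensor_surjective (Localization.Away b) hπ
  haveI : Module.Free (Localization.Away b) (Localization.Away b ⊗[B] N) :=
    Module.Free.of_equiv (LocalizedModule.equivTensorProduct (Submonoid.powers b) N)
  obtain ⟨σ, hσ⟩ := Module.projective_lifting_property (π.baseChange (Localization.Away b))
    LinearMap.id hπL
  obtain ⟨ρ, hρ⟩ := (hexL.splitInjectiveEquiv hπL).symm (hexL.splitSurjectiveEquiv hιL ⟨σ, hσ⟩)
  -- Step 2: `k` is an algebra over `L`
  letI : Algebra (Localization.Away b) k := (IsLocalization.Away.lift b hb).toAlgebra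
  haveI : IsScalarTower B (Localization.Away b) k := IsScalarTower.of_algebraMap_eq fun x => by
    rw [RingHom.algebraMap_toAlgebra]
    exact (IsLocalization.Away.lift_eq b hb x).symm
  -- the comparison `k ⊗_L (L ⊗_B X) ≃ k ⊗_B X` is compatible with `ι`
  let e' := TensorProduct.AlgebraTensorModule.cancelBaseChange B (Localization.Away b) k k M'
  let e := TensorProduct.AlgebraTensorModule.cancelBaseChange B (Localization.Away b) k k M
  have hnat : ∀ z, e (((ι.baseChange (Localization.Away b)).lTensor k) z) = (ι.lTensor k) (e' z) := by
    intro z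
    induction z using TensorProduct.induction_on with
    | zero => simp
    | add z₁ z₂ h₁ h₂ => simp only [map_add, h₁, h₂]
    | tmul x w =>
      induction w using TensorProduct.induction_on with
      | zero => simp
      | add w₁ w₂ h₁ h₂ => simp only [TensorProduct.tmul_add, map_add, h₁, h₂]
      | tmul l m =>
        simp [e, e', LinearMap.baseChange_tmul]
  -- Step 3: conclude
  rw [injective_iff_map_eq_zero]
  intro y hy
  obtain ⟨z, rfl⟩ := e'.surjective y
  have hz : ((ι.baseChange (Localization.Away b)).lTensor k) z = 0 := by
    apply e.injective
    rw [hnat, hy, map_zero]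
  have : z = (ρ.lTensor k) (((ι.baseChange (Localization.Away b)).lTensor k) z) := by
    rw [← LinearMap.comp_apply, ← LinearMap.lTensor_comp, hρ, LinearMap.lTensor_id,
      LinearMap.id_apply]
  rw [this, hz, map_zero, map_zero]

end SplitInjective

section Nontrivial

variable {B : Type u} [CommRing B] [IsDomain B]

/-- **Non-empty generic fibre ⇒ non-trivial fibre rings over a dense open** (Chevalley): if the
finite type algebra `A` over the Noetherian domain `B` has a prime lying over `(0)`, then there
is `b ≠ 0` such that `k ⊗_B A ≠ 0` for every field-valued point `B → k` with `b ↦ ≠ 0`.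
[folklore] -/
theorem exists_forall_nontrivial_tensor [IsNoetherianRing B] (A : Type u) [CommRing A]
    [Algebra B A] [Algebra.FiniteType B A]
    (h0 : ∃ Q : Ideal A, Q.IsPrime ∧ Q.comap (algebraMap B A) = ⊥) :
    ∃ b : B, b ≠ 0 ∧ ∀ (k : Type u) [Field k] [Algebra B k], algebraMap B k b ≠ 0 →
      Nontrivial (k ⊗[B] A) := by
  haveI := locallyOfFinitePresentation_specMap_algebraMap (B := B) A
  set f := Spec.map (CommRingCat.ofHom (algebraMap B A)) with hf
  have hgen : (⊥ : PrimeSpectrum B) ∈ Set.range f := by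
    obtain ⟨Q, hQ, hQB⟩ := h0
    exact ⟨⟨Q, hQ⟩, PrimeSpectrum.ext hQB⟩
  obtain ⟨b, hb, hbf⟩ := exists_basicOpen_subset_range f hgen
  refine ⟨b, hb, fun k _ _ hbk => ?_⟩
  have hne : Nonempty ↑(pullback f (Spec.map (CommRingCat.ofHom (algebraMap B k)))) :=
    nonempty_pullback_of_subset_range f hbf (algebraMap B k) hbk
  haveI : Nontrivial (A ⊗[B] k) := by
    refine nontrivial_of_nonempty_spec ?_
    obtain ⟨z⟩ := hne
    exact ⟨(pullbackSpecIso B A k).hom z⟩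
  exact (Algebra.TensorProduct.comm B A k).injective.nontrivial

end Nontrivial

section NonVanishing

variable {B : Type u} [CommRing B] [IsDomain B] {R : Type u} [CommRing R] [Algebra B R]

open Literature.RingTheory.Flat in
/-- **Non-vanishing in the generic fibre spreads to the fibres over a dense open** (generic
freeness, Görtz–Wedhorn I Thm. 10.83, for `R/(r)`; Chevalley for `R/Ann(r)`): if `b · r ≠ 0` for
all `b ≠ 0` (i.e. `1 ⊗ r ≠ 0` in `K ⊗_B R`), then there is `b ≠ 0` such that `1 ⊗ r ≠ 0` in the
fibre `k ⊗_B R` at every field-valued point `B → k` with `b ↦ ≠ 0`.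
[cite: GortzWedhorn2020, Thm. 10.83] -/
theorem exists_forall_one_tmul_ne_zero [IsNoetherianRing B] [Algebra.FiniteType B R]
    (hGF : GortzWedhorn2020_10_83.{u}) (r : R) (h0 : ∀ b : B, b ≠ 0 → b • r ≠ 0) :
    ∃ b : B, b ≠ 0 ∧ ∀ (k : Type u) [Field k] [Algebra B k], algebraMap B k b ≠ 0 →
      (1 : k) ⊗ₜ[B] r ≠ 0 := by
  classical
  -- `Ann = Ann_R(r)`, `R'' = R/Ann ≅ Rr` via `x ↦ x r`, and the exact sequence `0 → R'' → R → R/(r) → 0`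
  set φ : R →ₗ[R] R := LinearMap.toSpanSingleton R R r with hφ
  set Ann : Ideal R := LinearMap.ker φ with hAnn
  have hmemAnn : ∀ x : R, x ∈ Ann ↔ x * r = 0 := fun x => by
    rw [hAnn, LinearMap.mem_ker, hφ, LinearMap.toSpanSingleton_apply, smul_eq_mul]
  let ι : (R ⧸ Ann) →ₗ[B] R := (Ann.liftQ φ le_rfl).restrictScalars B
  have hιmk : ∀ x : R, ι (Ideal.Quotient.mk Ann x) = x * r := fun x => by
    change Ann.liftQ φ le_rfl (Submodule.Quotient.mk x) = x * r
    rw [Submodule.liftQ_apply, hφ, LinearMap.toSpanSingleton_apply, smul_eq_mul]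
  have hι : Function.Injective ι := by
    rw [← LinearMap.ker_eq_bot]
    change LinearMap.ker ((Ann.liftQ φ le_rfl).restrictScalars B) = ⊥
    rw [LinearMap.ker_restrictScalars, Submodule.ker_liftQ_eq_bot _ _ _ le_rfl,
      Submodule.restrictScalars_bot]
  let π : R →ₗ[B] R ⧸ Ideal.span {r} := (Ideal.Quotient.mkₐ B (Ideal.span {r})).toLinearMap
  have hπ : Function.Surjective π := Ideal.Quotient.mkₐ_surjective B _
  have hex : Function.Exact ι π := by
    intro x
    change Ideal.Quotient.mk (Ideal.span {r}) x = 0 ↔ x ∈ Set.range ι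
    rw [Ideal.Quotient.eq_zero_iff_mem, Ideal.mem_span_singleton']
    constructor
    · rintro ⟨a, rfl⟩
      exact ⟨Ideal.Quotient.mk Ann a, hιmk a⟩
    · rintro ⟨y, rfl⟩
      obtain ⟨a, rfl⟩ := Ideal.Quotient.mk_surjective y
      exact ⟨a, (hιmk a).symm⟩
  -- generic freeness for `R/(r)` gives `b₁`
  obtain ⟨b₁, hb₁, hfree⟩ := hGF B R (R ⧸ Ideal.span {r}) inferInstance inferInstance
  -- Chevalley for `R/Ann` gives `b₂`: a prime of `R/Ann` over `(0)`
  have hdisj : Disjoint (Ann : Set R) (Algebra.algebraMapSubmonoid R (nonZeroDivisors B)) := by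
    refine Set.disjoint_left.mpr ?_
    rintro x hx ⟨b, hb, rfl⟩
    refine h0 b (nonZeroDivisors.ne_zero hb) ?_
    rw [Algebra.smul_def]
    exact (hmemAnn _).mp hx
  obtain ⟨Q, hQ, hAnnQ, hQdisj⟩ :=
    Ideal.exists_le_prime_disjoint Ann (Algebra.algebraMapSubmonoid R (nonZeroDivisors B)) hdisj
  have hQB : Q.comap (algebraMap B R) = ⊥ := by
    refine eq_bot_iff.mpr fun b hb => ?_
    by_contra hb0
    exact Set.disjoint_left.mp hQdisj (Ideal.mem_comap.mp hb)
      ⟨b, mem_nonZeroDivisors_of_ne_zero hb0, rfl⟩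
  haveI := hQ
  have hprime : (Q.map (Ideal.Quotient.mk Ann)).IsPrime :=
    Ideal.map_isPrime_of_surjective Ideal.Quotient.mk_surjective (by rwa [Ideal.mk_ker])
  have hover : (Q.map (Ideal.Quotient.mk Ann)).comap (algebraMap B (R ⧸ Ann)) = ⊥ := by
    rw [IsScalarTower.algebraMap_eq B R (R ⧸ Ann), ← Ideal.comap_comap, Ideal.Quotient.algebraMap_eq,
      Ideal.comap_map_of_surjective _ Ideal.Quotient.mk_surjective,
      ← RingHom.ker_eq_comap_bot, Ideal.mk_ker, sup_eq_left.mpr hAnnQ]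
    exact hQB
  obtain ⟨b₂, hb₂, hnt⟩ :=
    exists_forall_nontrivial_tensor (B := B) (R ⧸ Ann) ⟨_, hprime, hover⟩
  -- conclusion with `b = b₁ b₂`
  refine ⟨b₁ * b₂, mul_ne_zero hb₁ hb₂, fun k _ _ hbk hzero => ?_⟩
  rw [map_mul, mul_ne_zero_iff] at hbk
  have hinj : Function.Injective (ι.lTensor k) :=
    lTensor_injective_of_free_localizedModule hι hex hπ b₁ hfree k (isUnit_iff_ne_zero.mpr hbk.1)
  haveI := hnt k hbk.2
  have h1 : (ι.lTensor k) ((1 : k) ⊗ₜ[B] (1 : R ⧸ Ann)) = (1 : k) ⊗ₜ[B] r := by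
    rw [LinearMap.lTensor_tmul, ← map_one (Ideal.Quotient.mk Ann), hιmk, one_mul]
  have h2 : (1 : k) ⊗ₜ[B] (1 : R ⧸ Ann) = 0 := hinj (by rw [h1, hzero, map_zero])
  exact one_ne_zero (h2 : (1 : k ⊗[B] (R ⧸ Ann)) = 0)

end NonVanishing

section Main

variable {B : Type u} [CommRing B] [IsDomain B] (K : Type u) [Field K] [Algebra B K]
  [IsFractionRing B K] {R : Type u} [CommRing R] [Algebra B R]

omit [IsDomain B] [IsFractionRing B K] in
/-- `algebraMap B K b ⊗ 1` is a unit of `K ⊗_B R` for `b ≠ 0`. [folklore] -/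
theorem isUnit_algebraMap_tmul_one {b : B} (hb : algebraMap B K b ≠ 0) :
    IsUnit (algebraMap B K b ⊗ₜ[B] (1 : R)) :=
  (isUnit_iff_ne_zero.mpr hb).map (Algebra.TensorProduct.includeLeft : K →ₐ[B] K ⊗[B] R)

omit [IsDomain B] in
/-- A prime of `K ⊗_B R` avoiding `1 ⊗ r` contracts to a prime of `R` avoiding `r` and lying over
`(0)`. [folklore] -/
theorem exists_prime_notMem_of_not_isNilpotent {r : R} (h : ¬ IsNilpotent ((1 : K) ⊗ₜ[B] r)) :
    ∃ Q : Ideal R, Q.IsPrime ∧ r ∉ Q ∧ Q.comap (algebraMap B R) = ⊥ := by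
  rw [nilpotent_iff_mem_prime] at h
  push Not at h
  obtain ⟨P, hP, hrP⟩ := h
  refine ⟨P.comap (Algebra.TensorProduct.includeRight : R →ₐ[B] K ⊗[B] R), Ideal.IsPrime.comap _,
    fun hr => hrP (by simpa using hr), ?_⟩
  refine eq_bot_iff.mpr fun b hb => ?_
  by_contra hb0
  rw [Ideal.mem_comap, Ideal.mem_comap] at hb
  have hb' : algebraMap B K b ⊗ₜ[B] (1 : R) ∈ P := by
    have : (Algebra.TensorProduct.includeRight : R →ₐ[B] K ⊗[B] R) (algebraMap B R b) =
        algebraMap B K b ⊗ₜ[B] (1 : R) := by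
      rw [AlgHom.commutes, Algebra.TensorProduct.algebraMap_apply]
    rw [← this]
    exact hb
  exact hP.ne_top (Ideal.eq_top_of_isUnit_mem _ hb'
    (isUnit_algebraMap_tmul_one K (fun h => hb0 ((injective_iff_map_eq_zero _).mp
      (IsFractionRing.injective B K) b h))))

open Literature.RingTheory.Flat in
/-- **A non-integral generic fibre spreads**: let `B` be a Noetherian domain with fraction field
`K` and `R` a `B`-algebra of finite type. If the generic fibre `K ⊗_B R` is not an integral
domain, then there is `b ≠ 0` such that the fibre `k ⊗_B R` is not an integral domain at every
field-valued point `B → k` of `D(b)`. Three cases: `K ⊗_B R = 0` (then `b · 1 = 0` in `R` for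
some `b ≠ 0`); zero-divisors `1 ⊗ r`, `1 ⊗ s` which are not nilpotent (their non-nilpotency
spreads by Chevalley, `exists_forall_not_isNilpotent_one_tmul`); a non-zero nilpotent `1 ⊗ r`
(its non-vanishing spreads by generic freeness, `exists_forall_one_tmul_ne_zero`). [cite: GortzWedhorn2020, Thm. 10.83] -/
theorem exists_forall_not_isDomain_tensor [IsNoetherianRing B] [Algebra.FiniteType B R]
    (hGF : GortzWedhorn2020_10_83.{u}) (hK : ¬ IsDomain (K ⊗[B] R)) :
    ∃ b : B, b ≠ 0 ∧ ∀ (k : Type u) [Field k] [Algebra B k], algebraMap B k b ≠ 0 →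
      ¬ IsDomain (k ⊗[B] R) := by
  classical
  by_cases hnt : Nontrivial (K ⊗[B] R)
  · -- zero divisors `x y = 0`, `x, y ≠ 0`, cleared of denominators
    have hzd : ∃ x y : K ⊗[B] R, x * y = 0 ∧ x ≠ 0 ∧ y ≠ 0 := by
      by_contra hcon
      push Not at hcon
      refine hK ((isDomain_iff_noZeroDivisors_and_nontrivial _).mpr ⟨⟨fun {a b} hab => ?_⟩, hnt⟩)
      by_contra h
      push Not at h
      exact h.2 (hcon a b hab h.1)
    obtain ⟨x, y, hxy, hx, hy⟩ := hzd
    obtain ⟨bx, hbx, rx, hrx⟩ := exists_mul_eq_one_tmul K x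
    obtain ⟨bY, hbY, ry, hry⟩ := exists_mul_eq_one_tmul K y
    have hKinj : ∀ {b : B}, b ≠ 0 → algebraMap B K b ≠ 0 := fun hb h =>
      hb ((injective_iff_map_eq_zero _).mp (IsFractionRing.injective B K) _ h)
    have hux := isUnit_algebraMap_tmul_one K (R := R) (hKinj hbx)
    have huy := isUnit_algebraMap_tmul_one K (R := R) (hKinj hbY)
    have hrx0 : (1 : K) ⊗ₜ[B] rx ≠ 0 := fun h => hx (by
      rw [← hux.mul_right_eq_zero, hrx, h])
    have hry0 : (1 : K) ⊗ₜ[B] ry ≠ 0 := fun h => hy (by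
      rw [← huy.mul_right_eq_zero, hry, h])
    have hprod : (1 : K) ⊗ₜ[B] (rx * ry) = 0 := by
      have e : (1 : K) ⊗ₜ[B] (rx * ry) = ((1 : K) ⊗ₜ[B] rx) * ((1 : K) ⊗ₜ[B] ry) := by
        rw [Algebra.TensorProduct.tmul_mul_tmul, one_mul]
      rw [e, ← hrx, ← hry, mul_mul_mul_comm, hxy, mul_zero]
    obtain ⟨b₀, hb₀, hb₀r⟩ := (one_tmul_eq_zero_iff K (rx * ry)).mp hprod
    -- in every fibre over `D(b₀)`, `(1 ⊗ rx)(1 ⊗ ry) = 0`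
    have hfib : ∀ (k : Type u) [Field k] [Algebra B k], algebraMap B k b₀ ≠ 0 →
        ((1 : k) ⊗ₜ[B] rx) * ((1 : k) ⊗ₜ[B] ry) = 0 := fun k _ _ hk => by
      rw [Algebra.TensorProduct.tmul_mul_tmul, one_mul]
      exact one_tmul_eq_zero_of_smul_eq_zero (isUnit_iff_ne_zero.mpr hk) hb₀r
    by_cases hnx : IsNilpotent ((1 : K) ⊗ₜ[B] rx)
    · -- `1 ⊗ rx` is a non-zero nilpotent: non-reducedness spreads
      obtain ⟨N, hN⟩ := hnx
      rw [Algebra.TensorProduct.tmul_pow, one_pow] at hN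
      obtain ⟨b₁, hb₁, hb₁r⟩ := (one_tmul_eq_zero_iff K (rx ^ N)).mp hN
      have h0 : ∀ b : B, b ≠ 0 → b • rx ≠ 0 := fun b hb h =>
        hrx0 ((one_tmul_eq_zero_iff K rx).mpr ⟨b, hb, h⟩)
      obtain ⟨b₂, hb₂, hne⟩ := exists_forall_one_tmul_ne_zero hGF rx h0
      refine ⟨b₁ * b₂, mul_ne_zero hb₁ hb₂, fun k _ _ hk hdom => ?_⟩
      rw [map_mul, mul_ne_zero_iff] at hk
      haveI := hdom
      refine hne k hk.2 (IsNilpotent.eq_zero ⟨N, ?_⟩)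
      rw [Algebra.TensorProduct.tmul_pow, one_pow]
      exact one_tmul_eq_zero_of_smul_eq_zero (isUnit_iff_ne_zero.mpr hk.1) hb₁r
    by_cases hny : IsNilpotent ((1 : K) ⊗ₜ[B] ry)
    · obtain ⟨N, hN⟩ := hny
      rw [Algebra.TensorProduct.tmul_pow, one_pow] at hN
      obtain ⟨b₁, hb₁, hb₁r⟩ := (one_tmul_eq_zero_iff K (ry ^ N)).mp hN
      have h0 : ∀ b : B, b ≠ 0 → b • ry ≠ 0 := fun b hb h =>
        hry0 ((one_tmul_eq_zero_iff K ry).mpr ⟨b, hb, h⟩)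
      obtain ⟨b₂, hb₂, hne⟩ := exists_forall_one_tmul_ne_zero hGF ry h0
      refine ⟨b₁ * b₂, mul_ne_zero hb₁ hb₂, fun k _ _ hk hdom => ?_⟩
      rw [map_mul, mul_ne_zero_iff] at hk
      haveI := hdom
      refine hne k hk.2 (IsNilpotent.eq_zero ⟨N, ?_⟩)
      rw [Algebra.TensorProduct.tmul_pow, one_pow]
      exact one_tmul_eq_zero_of_smul_eq_zero (isUnit_iff_ne_zero.mpr hk.1) hb₁r
    · -- genuine zero divisors: non-nilpotency of both spreads
      obtain ⟨cx, hcx, hcx'⟩ := exists_forall_not_isNilpotent_one_tmul rx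
        (exists_prime_notMem_of_not_isNilpotent K hnx)
      obtain ⟨cy, hcy, hcy'⟩ := exists_forall_not_isNilpotent_one_tmul ry
        (exists_prime_notMem_of_not_isNilpotent K hny)
      refine ⟨b₀ * cx * cy, mul_ne_zero (mul_ne_zero hb₀ hcx) hcy, fun k _ _ hk hdom => ?_⟩
      rw [map_mul, map_mul, mul_ne_zero_iff, mul_ne_zero_iff] at hk
      haveI := hdom
      rcases mul_eq_zero.mp (hfib k hk.1.1) with h | h
      · exact hcx' k hk.1.2 (h ▸ IsNilpotent.zero)
      · exact hcy' k hk.2 (h ▸ IsNilpotent.zero)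
  · -- `K ⊗_B R = 0`: then `b · 1 = 0` in `R` for some `b ≠ 0`, and all nearby fibres vanish
    rw [not_nontrivial_iff_subsingleton] at hnt
    have h1 : (1 : K) ⊗ₜ[B] (1 : R) = 0 := Subsingleton.elim _ _
    obtain ⟨b, hb, hb1⟩ := (one_tmul_eq_zero_iff K (1 : R)).mp h1
    refine ⟨b, hb, fun k _ _ hk hdom => ?_⟩
    haveI := hdom
    exact one_ne_zero ((one_tmul_eq_zero_of_smul_eq_zero (isUnit_iff_ne_zero.mpr hk) hb1 :
      ((1 : k) ⊗ₜ[B] (1 : R)) = 0))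

end Main

section MvPolynomial

variable {B : Type u} [CommRing B]

/-- The fibres of `Spec (B[x₁, …, xₙ]/J) → Spec B`: for a `B`-algebra `k`,
`k ⊗_B (B[x]/J) ≅ k[x]/(J·k[x])`, `J·k[x]` the ideal generated by the images of `J` under
`B[x] → k[x]` (coefficientwise `B → k`). [folklore] -/
theorem map_includeRight_map_algebraTensorAlgEquiv (k : Type u) [CommRing k] [Algebra B k]
    {σ : Type u} (J : Ideal (MvPolynomial σ B)) :
    J.map (MvPolynomial.map (algebraMap B k)) =
      (J.map (Algebra.TensorProduct.includeRight :
          MvPolynomial σ B →ₐ[B] k ⊗[B] MvPolynomial σ B)).map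
        ((MvPolynomial.algebraTensorAlgEquiv B k : k ⊗[B] MvPolynomial σ B ≃ₐ[k] MvPolynomial σ k) :
          k ⊗[B] MvPolynomial σ B →+* MvPolynomial σ k) := by
  have key : ∀ j : MvPolynomial σ B,
      ((MvPolynomial.algebraTensorAlgEquiv B k : k ⊗[B] MvPolynomial σ B ≃ₐ[k] MvPolynomial σ k) :
        k ⊗[B] MvPolynomial σ B →+* MvPolynomial σ k)
        ((Algebra.TensorProduct.includeRight : MvPolynomial σ B →ₐ[B] k ⊗[B] MvPolynomial σ B) j) =
      MvPolynomial.map (algebraMap B k) j := fun j => by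
    change MvPolynomial.algebraTensorAlgEquiv B k ((1 : k) ⊗ₜ[B] j) = _
    rw [MvPolynomial.algebraTensorAlgEquiv_tmul, one_smul]
  apply le_antisymm
  · rw [Ideal.map_le_iff_le_comap]
    intro j hj
    rw [Ideal.mem_comap, ← key]
    exact Ideal.mem_map_of_mem _ (Ideal.mem_map_of_mem _ hj)
  · rw [Ideal.map_le_iff_le_comap, Ideal.map_le_iff_le_comap]
    intro j hj
    rw [Ideal.mem_comap, Ideal.mem_comap, key]
    exact Ideal.mem_map_of_mem _ hj

/-- **The fibre rings of the family `Spec (B[x₁, …, xₙ]/J) → Spec B`**: for every `B`-algebra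
`k`, `k ⊗_B (B[x]/J) ≃ₐ[k] k[x]/(J·k[x])` (Mathlib's `tensorQuotientEquiv` and
`MvPolynomial.algebraTensorAlgEquiv`). [folklore] -/
def tensorQuotientMvPolynomialEquiv (k : Type u) [CommRing k] [Algebra B k] {σ : Type u}
    (J : Ideal (MvPolynomial σ B)) :
    k ⊗[B] (MvPolynomial σ B ⧸ J) ≃ₐ[k]
      MvPolynomial σ k ⧸ J.map (MvPolynomial.map (algebraMap B k)) :=
  (Algebra.TensorProduct.tensorQuotientEquiv (R := B) k (MvPolynomial σ B) k J).trans
    (Ideal.quotientEquivAlg _ _ (MvPolynomial.algebraTensorAlgEquiv B k)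
      (map_includeRight_map_algebraTensorAlgEquiv k J))

variable [IsDomain B] (K : Type u) [Field K] [Algebra B K] [IsFractionRing B K]

open Literature.RingTheory.Flat in
/-- **Non-integrality of the zero scheme of a family of polynomials spreads from the generic
point**: let `B` be a Noetherian domain with fraction field `K` and `J ⊆ B[x₁, …, xₙ]` an ideal.
If `K[x]/(J·K[x])` is not an integral domain, then there is `b ≠ 0` such that `k[x]/(J·k[x])` is
not an integral domain for every field-valued point `B → k` of `D(b)` — no fibre of
`V(J) → Spec B` over `D(b)` is integral. (`exists_forall_not_isDomain_tensor` transported along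
`tensorQuotientMvPolynomialEquiv`.) [cite: GortzWedhorn2020, Thm. 10.83] -/
theorem exists_forall_not_isDomain_mvPolynomial [IsNoetherianRing B] {σ : Type u} [Finite σ]
    (hGF : GortzWedhorn2020_10_83.{u}) (J : Ideal (MvPolynomial σ B))
    (hK : ¬ IsDomain (MvPolynomial σ K ⧸ J.map (MvPolynomial.map (algebraMap B K)))) :
    ∃ b : B, b ≠ 0 ∧ ∀ (k : Type u) [Field k] [Algebra B k], algebraMap B k b ≠ 0 →
      ¬ IsDomain (MvPolynomial σ k ⧸ J.map (MvPolynomial.map (algebraMap B k))) := by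
  haveI : Algebra.FiniteType B (MvPolynomial σ B ⧸ J) := inferInstance
  have hK' : ¬ IsDomain (K ⊗[B] (MvPolynomial σ B ⧸ J)) := fun h =>
    hK (MulEquiv.isDomain (K ⊗[B] (MvPolynomial σ B ⧸ J))
      (tensorQuotientMvPolynomialEquiv K J).symm.toMulEquiv)
  obtain ⟨b, hb, h⟩ := exists_forall_not_isDomain_tensor K hGF hK'
  refine ⟨b, hb, fun k _ _ hk hdom => h k hk ?_⟩
  haveI := hdom
  exact MulEquiv.isDomain _ (tensorQuotientMvPolynomialEquiv k J).toMulEquiv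

end MvPolynomial

end Literature.AlgebraicGeometry.Limits

end
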